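import Literature.MathematicalPhysics.QuantumFieldTheory.Balaban1983to89.B9Thm311InvAtHIWitnessCubeZd
import Literature.MathematicalPhysics.QuantumFieldTheory.Balaban1983to89.B9SupplySockB9P3ZdInstance

/-!
# `Balaban1983to89.B9Thm311InvAtHIWitnessCubeZdFamily` — [Balaban1985BackgroundPropagators] (3.27) p. 395 ∕ Thm 3.11 p. 416 ∕ [Balaban1985RegularSpaces] (1.58)
# p. 86: THE (3.27) WITNESS OF `B9Thm311InvAtHIWitnessCubeZd` MADE UNIFORM IN THE BLOCK PARAMETER `M` AND OVER FINITE INDEX FAMILIES, AND THE β COLLAR SOCKET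
# AT THE CONCRETE `ℤᵈ` FRAME (`geoZd ∕ bgZd ∕ GAZdFam ∕ memZd ∕ ιCfgZd ∕ ιLocZd`) WITH THE DICTIONARY `DictAt` DISCHARGED — consumer conveniences for the
# family supplier `B9SupplySockB9P3ZdAtHermInAk.sockB9P3D4γIHI_allLevels_of_thm33_on` (`hinv : ∀ M j m, M₃ ≤ M → InvAtHI … aI M (ι j) m`)

statement-level skeleton of published theorems with citation tags; proofs where landed; nothing here is a claim about the
Yang–Mills mass gap

`[Balaban1985BackgroundPropagators]` ("B9", CMP **99** (1985) 389–434; journal page = PDF page + 388): (3.27) p. 395, (3.26) p. 395, (3.20)–(3.25) p. 394,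
Thm 3.11 p. 416, Thm 3.3 p. 399, (3.47) p. 398.  `[Balaban1985RegularSpaces]` ("B8", CMP **99** (1985) 75–102): (1.7) p. 77, (1.33) p. 82, (1.58)–(1.59)
p. 86, (1.131) p. 99.  `[Balaban1984PropagatorsII]` (2.2)–(2.3) p. 224 («M is a size of big blocks»).

CITATION HEADER ∕ WHY THIS FILE (cell `pub-ymgap`, HUMAN RULING D-0062; seat `pub-ymgap-dag-n06-b` (g20)).  `B9Thm311InvAtHIWitnessCubeZd.invAtHI_withGopZdH_
opsAllZd_cube` gives, at each cube member and each `(M, m)`, SOME `aI > 0`.  The family binder of the member suppliers quantifies `∀ M ≥ M₃` with ONE `aI`;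
§§1–3 show the genuine record's `Δ_a(U₀)` at a member with finite `Ω₀` does not read `M` at all (the only `M`-slot of `opsAllZd`'s co-letters is the
infinite-`Ω₀` fallback of `D R 𝟙 D*`), so the witness is uniform in `M`, and over a FINITE index family of cube members one `aI` serves all (`min`).  §4 states
`B9Thm311InvAtHIWitnessCubeZd.sockB9P3D4γ_withGopZdH_opsAllZd_cube` at the concrete `ℤᵈ` frame of `B9SupplySockB9P3ZdFrame`, where the dictionary hypothesis
`hdict` is a THEOREM (`B9SupplySockB9P3ZdInstance.dictGlob_zd`, dag-n06-e∕this lineage g4) — leaving Prop. 6 (`Prop6At`, dag-n05-e's `prop6At_bgZd_cubeFam_holds`)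
and Theorem 3.3's (3.42)∕(3.47) block `h33U` for the genuine `G_𝔤` as the ONLY displayed inputs of the β collar socket at a cube member.

WHAT IS PROVED (kernel, 0 sorry, 0 def; no `instance`, no `notation`).
* §1 record congruence at one background: `deltaADom_congr_ops`, `regularAtH_congr_ops`, `bondPair_deltaAOf_congr_ops`.
* §2 `deltaAOf_opsAllZd_indepM` (finite `Ω₀`: the genuine `Δ_a(U₀)A` is the same for all `M`), `regularAtH_opsAllZd_indepM`, `posDefH_opsAllZd_indepM`.
* §3 ★★ `regularAtH_of_inAk_cube_allM` ∕ ★★ `invAtHI_withGopZdH_opsAllZd_cube_allM` (`∃ aI > 0, ∀ M, InvAtHI … aI M i m`), ★★ `invAtHI_withGopZdH_opsAllZd_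
  cube_finite` (finite index families of cube members: ONE `aI` for all `j`, all `M`, all `m ≤ k_j`, by `min`).
* §4 ★★★ `sockB9P3D4γ_withGopZdH_opsAllZd_cube_zd` — at `geoZd ∕ bgZd ∕ GAZdFam … ops loc ∕ memZd ∕ ιCfgZd ∕ ιLocZd`: `hP6` + `h33U` ⟹ `∃ aI > 0, SockB9P3D4β …`.

HONEST SCOPE.  Bookkeeping over landed theorems; `aI` still member-dependent across INFINITE families (print's uniform Thm 3.11 not proved); `hP6`, `h33U`
displayed; count-neutral helper of K1⁸ (`--supports stmt-QuantumFields-26907`); N05∕N06 NOT discharged; one finite `𝕋⁴` programme at fixed `ε`, Bałaban as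
printed; R4 closes only the conditional finite-`𝕋⁴` rung `BalabanLadder.UV` — nothing continuum ∕ `ℝ⁴` ∕ OS ∕ mass gap ∕ Clay.  Unit `pub-ymgap-dag-n06-b`
(g20), 2026-08-28.
-/

noncomputable section

open scoped BigOperators
open NormedSpace

namespace Literature.MathematicalPhysics.QuantumFieldTheory.Balaban1983to89.B9Thm311InvAtHIWitnessCubeZdFamily

open B7Prop1Explicit (e gaugeAct)
open B7Prop2Explicit (unitaryUnits)
open B8Ineq132 (PlaqTouches BondTouches plaqF InAk covDerivFwd)
open B8Eq131Cubes (cube sqLo sqHi)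
open B8Eq131CubesAdmissible (cubeFam cubeFam_false_zero)
open B8CubeMemberZd (cubeLamS)
open B8Ineq159FlatCubeMemberPrinted (cubeLamBP)
open B8LeafModelZd (ZdIdx)
open B8Eq155JBound (Jcur)
open B8Eq138LandauZd (covDivB)
open B9Eq369CurvSmallZd (DpZd)
open B9SupplySockB9P3ZdLetters (OpsZd deltaAOf)
open B9SupplySockB9P3ZdLettersOmega (OnDom restrictDom)
open B9SupplySockB9P3ZdAt (DictAt Prop6At dictAt_of_global)
open B9SupplySockB9P3ZdBeta (SockB9P3D4β)
open B9Eq321LandauProjectionZd (opsLandau projR opsLandau_DRDs_of_finite)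
open B9Eq327GreenZd (domSub bondPair deltaADom bondPair_restrictDom_right)
open B9Eq327GreenZdHerm (domSubH RegularAtH gopZdH withGopZdH withGopZdH_Gop deltaAOf_withGopZdH gopZdH_apply_eq_of_regularAtH)
open B9Eq316AveragingTransposeZd (Reg17 alphaQ qQ betaTau)
open B9Eq316AveragingTransposeZdPrinted (QQZdP withQQP)
open B9SupplySockB9P3ZdGammaInAkDpZd (withDpZd)
open B9SupplySockB9P3ZdAllLettersZd (opsAllZd)
open B9SupplySockB9P3ZdAtHermInAk (InvAtHI invAtHI_anti invAtHI_of_forall)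
open B9Thm311PerMemberCubeZdTouching (regularAtH_of_inAk_cube posDefH_of_inAk_cube)
open B9Thm311InvAtHIWitnessCubeZd (sockB9P3D4γ_withGopZdH_opsAllZd_cube)
open B9SupplySockB9P3ZdFrame (MemberZd geoZd bgZd memZd ιCfgZd ιLocZd GAZdFam LocalLettersZd)
open B9SupplySockB9P3ZdInstance (dictGlob_zd)

export B7Prop1Explicit (Site)

variable {d : ℕ}

/-! ## §1 Two records whose `Δ_a` agree on the bonds of `Ω₀` at one background -/

section Records

variable {𝔸 : Type*} [CStarAlgebra 𝔸]

/-- `Δ_a↾Ω₀` of two records agreeing on the bonds of `Ω₀` at `U₀`. [cite: Balaban1985BackgroundPropagators, (3.27) p.395 («Ω₀Δ_aΩ₀»)] -/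
theorem deltaADom_congr_ops (η : ℝ) (o o' : OpsZd d 𝔸) (Ω₀ : Set (Site d)) {U : Site d → Fin d → 𝔸ˣ} {A : Site d → Fin d → 𝔸}
    (h : ∀ (y : Site d) (τ : Fin d), BondTouches Ω₀ y τ → deltaAOf η o U A y τ = deltaAOf η o' U A y τ) :
    deltaADom η o Ω₀ U A = deltaADom η o' Ω₀ U A := by
  classical
  funext y τ
  simp only [deltaADom, restrictDom]
  split_ifs with hb
  · exact h y τ hb
  · rfl

/-- `RegularAtH` transfers between two records whose `Δ_a↾Ω₀` agree on `E_𝔤(Ω₀)` at `U₀`. [cite: Balaban1985BackgroundPropagators, (3.27) p.395, Thm 3.11 p.416] -/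
theorem regularAtH_congr_ops (η : ℝ) (o o' : OpsZd d 𝔸) (Ω₀ : Set (Site d)) {U : Site d → Fin d → 𝔸ˣ}
    (h : ∀ A ∈ domSubH (𝔸 := 𝔸) Ω₀, deltaADom η o Ω₀ U A = deltaADom η o' Ω₀ U A) :
    RegularAtH η o Ω₀ U ↔ RegularAtH η o' Ω₀ U := by
  constructor
  · rintro ⟨Φ, hΦ, hbij⟩
    exact ⟨Φ, fun A => by rw [hΦ A, h A A.2], hbij⟩
  · rintro ⟨Φ, hΦ, hbij⟩
    exact ⟨Φ, fun A => by rw [hΦ A, ← h A A.2], hbij⟩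

/-- the pairing `⟨A, Δ_aA⟩_τ` on `E(Ω₀)` transfers between two records agreeing on the bonds of `Ω₀`. [cite: Balaban1985BackgroundPropagators, (3.27) p.395, Thm 3.11 p.416] -/
theorem bondPair_deltaAOf_congr_ops (τ : 𝔸 →ₗ[ℂ] ℂ) (η : ℝ) (o o' : OpsZd d 𝔸) (Ω₀ : Set (Site d)) {U : Site d → Fin d → 𝔸ˣ}
    {A : Site d → Fin d → 𝔸} (hA : A ∈ domSub (𝔸 := 𝔸) Ω₀)
    (h : ∀ (y : Site d) (μ : Fin d), BondTouches Ω₀ y μ → deltaAOf η o U A y μ = deltaAOf η o' U A y μ) :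
    bondPair τ A (deltaAOf η o U A) = bondPair τ A (deltaAOf η o' U A) := by
  rw [← bondPair_restrictDom_right τ hA (deltaAOf η o U A), ← bondPair_restrictDom_right τ hA (deltaAOf η o' U A)]
  exact congrArg _ (deltaADom_congr_ops η o o' Ω₀ h)

end Records

/-! ## §2 At a member with finite `Ω₀` the genuine `Δ_a(U₀)` does not read the block parameter `M` -/

section IndepM

variable {𝔸 : Type*} [CStarAlgebra 𝔸] [FiniteDimensional ℝ 𝔸] (τ : 𝔸 →ₗ[ℂ] ℂ) {L : ℕ}
  (ΛbP : ℕ → ℕ → Set (Site d × Fin d)) (ops₀ : ℝ → ZdIdx d L → ℕ → OpsZd d 𝔸) (i : ZdIdx d L) (m : ℕ)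

/-- **THE GENUINE FOUR-LETTER `Δ_a(U₀)A` IS THE SAME FOR EVERY BLOCK PARAMETER `M`** at a member with finite `Ω₀` (`D*D`, `Δ′`, `Q*aQ` carry no `M`; the
Landau letter reads `M` only in its infinite-`Ω₀` fallback). [cite: Balaban1985BackgroundPropagators, (3.26) p.395, (3.20)–(3.25) p.394; Balaban1984PropagatorsII, (2.2) p.224] -/
theorem deltaAOf_opsAllZd_indepM (hΩ : (i.Ω 0).Finite) (M M' : ℝ) (U₀ : Site d → Fin d → 𝔸ˣ) (A : Site d → Fin d → 𝔸) (x : Site d) (μ : Fin d) :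
    deltaAOf i.η (opsAllZd τ L ΛbP ops₀ M i m) U₀ A x μ = deltaAOf i.η (opsAllZd τ L ΛbP ops₀ M' i m) U₀ A x μ := by
  show Jcur i.η U₀ A μ x + DpZd i.η U₀ A x μ + (opsLandau τ (withDpZd (withQQP τ L ΛbP ops₀)) M i m).DRDs U₀ A x μ + QQZdP τ L ΛbP i m U₀ A x μ =
    Jcur i.η U₀ A μ x + DpZd i.η U₀ A x μ + (opsLandau τ (withDpZd (withQQP τ L ΛbP ops₀)) M' i m).DRDs U₀ A x μ + QQZdP τ L ΛbP i m U₀ A x μ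
  rw [opsLandau_DRDs_of_finite τ _ M i m hΩ, opsLandau_DRDs_of_finite τ _ M' i m hΩ]

/-- `RegularAtH` of the genuine record does not depend on `M` (finite `Ω₀`). [cite: Balaban1985BackgroundPropagators, (3.27) p.395] -/
theorem regularAtH_opsAllZd_indepM (hΩ : (i.Ω 0).Finite) (M M' : ℝ) (U₀ : Site d → Fin d → 𝔸ˣ) :
    RegularAtH i.η (opsAllZd τ L ΛbP ops₀ M i m) (i.Ω 0) U₀ ↔ RegularAtH i.η (opsAllZd τ L ΛbP ops₀ M' i m) (i.Ω 0) U₀ :=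
  regularAtH_congr_ops i.η _ _ (i.Ω 0) fun A _ =>
    deltaADom_congr_ops i.η _ _ (i.Ω 0) fun y τ' _ => deltaAOf_opsAllZd_indepM τ ΛbP ops₀ i m hΩ M M' U₀ A y τ'

/-- positivity of the genuine `Δ_a(U₀)` on `E_𝔤(Ω₀)` does not depend on `M` (finite `Ω₀`). [cite: Balaban1985BackgroundPropagators, Thm 3.11 p.416] -/
theorem posDefH_opsAllZd_indepM (hΩ : (i.Ω 0).Finite) (M M' : ℝ) (U₀ : Site d → Fin d → 𝔸ˣ) :
    (∀ A ∈ domSubH (𝔸 := 𝔸) (i.Ω 0), A ≠ 0 → 0 < bondPair τ A (deltaAOf i.η (opsAllZd τ L ΛbP ops₀ M i m) U₀ A)) ↔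
      (∀ A ∈ domSubH (𝔸 := 𝔸) (i.Ω 0), A ≠ 0 → 0 < bondPair τ A (deltaAOf i.η (opsAllZd τ L ΛbP ops₀ M' i m) U₀ A)) := by
  have key : ∀ A ∈ domSubH (𝔸 := 𝔸) (i.Ω 0), bondPair τ A (deltaAOf i.η (opsAllZd τ L ΛbP ops₀ M i m) U₀ A) =
      bondPair τ A (deltaAOf i.η (opsAllZd τ L ΛbP ops₀ M' i m) U₀ A) := fun A hA =>
    bondPair_deltaAOf_congr_ops τ i.η _ _ (i.Ω 0) (B9Eq327GreenZdHerm.domSubH_le _ hA)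
      fun y μ _ => deltaAOf_opsAllZd_indepM τ ΛbP ops₀ i m hΩ M M' U₀ A y μ
  exact ⟨fun h A hA hA0 => by rw [← key A hA]; exact h A hA hA0, fun h A hA hA0 => by rw [key A hA]; exact h A hA hA0⟩

end IndepM

/-! ## §3 The witnesses, uniform in `M` and over finite index families -/

section Uniform

variable {𝔸 : Type*} [CStarAlgebra 𝔸] [Nontrivial 𝔸] (τ : 𝔸 →ₗ[ℂ] ℂ) [FiniteDimensional ℝ 𝔸] {L : ℕ}
  (hτp : ∀ a : 𝔸, a ≠ 0 → 0 < (τ (star a * a)).re) (hτt : ∀ a b : 𝔸, τ (a * b) = τ (b * a))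
  (hτs : ∀ a : 𝔸, τ (star a) = starRingEnd ℂ (τ a))

include hτp hτt hτs in
/-- ★★ **THEOREM 3.11 AT ONE CUBE MEMBER FOR EVERY DATUM, UNIFORMLY IN THE BLOCK PARAMETER `M`**: one `α > 0` such that for every `M`, every `α₀ ≤ α` and
every unitary `U₀ ∈ 𝔄_m({□_j}, α₀)`, `RegularAtH` for `opsAllZd … M i m` and the (1.7) certificate. [cite: Balaban1985BackgroundPropagators, Thm 3.11 p.416, (3.27) p.395; Balaban1985RegularSpaces, (1.7) p.77, (1.131) p.99] -/
theorem regularAtH_of_inAk_cube_allM (hd2 : 2 ≤ d) (hL : 2 ≤ L) (ops₀ : ℝ → ZdIdx d L → ℕ → OpsZd d 𝔸) (i : ZdIdx d L)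
    {a : Site d} {Mc ρ : ℕ} (hρ : L ≤ ρ) (hΩ : i.Ω = cubeFam false L a Mc ρ i.k) (hΛs : i.Λs = cubeLamS L a Mc ρ i.k) {m : ℕ} (hm : m ≤ i.k) :
    ∃ α : ℝ, 0 < α ∧ ∀ (M α₀ : ℝ), α₀ ≤ α → ∀ U₀ : Site d → Fin d → 𝔸ˣ, (∀ x κ, U₀ x κ ∈ unitaryUnits 𝔸) →
      InAk L m i.η α₀ i.Ω U₀ →
        RegularAtH i.η (opsAllZd τ L (cubeLamBP L a Mc ρ i.k) ops₀ M i m) (i.Ω 0) U₀ ∧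
          Reg17 L m i.Ω (alphaQ d L / (L : ℝ) ^ 2) U₀ := by
  have hfin : (i.Ω 0).Finite := B9Thm311PosDefOpenZd.cubeMember_Ω0_finite i hΩ
  obtain ⟨α, hα, h⟩ := regularAtH_of_inAk_cube τ hτp hτt hτs hd2 hL ops₀ 0 i hρ hΩ hΛs hm
  refine ⟨α, hα, fun M α₀ hα₀ U₀ hU₀ hIn => ⟨?_, (h α₀ hα₀ U₀ hU₀ hIn).2⟩⟩
  exact (regularAtH_opsAllZd_indepM τ (cubeLamBP L a Mc ρ i.k) ops₀ i m hfin M 0 U₀).mpr (h α₀ hα₀ U₀ hU₀ hIn).1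

include hτp hτt hτs in
/-- ★★ **THE JUNCTION'S (3.27) BINDER INHABITED AT A CUBE MEMBER WITH ONE THRESHOLD FOR EVERY BLOCK PARAMETER `M`**: `∃ aI > 0, ∀ M, InvAtHI L (withGopZdH
(opsAllZd τ L (cubeLamBP …) ops₀)) aI M i m` — the shape of the family binder `∀ M ≥ M₃` of `sockB9P3D4γIHI_allLevels_of_thm33_on` at one member.
[cite: Balaban1985BackgroundPropagators, (3.27) p.395, Thm 3.11 p.416; Balaban1985RegularSpaces, (1.58) p.86, (1.7) p.77; Balaban1984PropagatorsII, (2.2) p.224] -/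
theorem invAtHI_withGopZdH_opsAllZd_cube_allM (hd2 : 2 ≤ d) (hL : 2 ≤ L) (ops₀ : ℝ → ZdIdx d L → ℕ → OpsZd d 𝔸) (i : ZdIdx d L)
    {a : Site d} {Mc ρ : ℕ} (hρ : L ≤ ρ) (hΩ : i.Ω = cubeFam false L a Mc ρ i.k) (hΛs : i.Λs = cubeLamS L a Mc ρ i.k) {m : ℕ} (hm : m ≤ i.k) :
    ∃ aI : ℝ, 0 < aI ∧ ∀ M : ℝ, InvAtHI L (withGopZdH (opsAllZd τ L (cubeLamBP L a Mc ρ i.k) ops₀)) aI M i m := by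
  obtain ⟨α, hα, h⟩ := regularAtH_of_inAk_cube_allM τ hτp hτt hτs hd2 hL ops₀ i hρ hΩ hΛs hm
  refine ⟨α, hα, fun M => invAtHI_of_forall L fun α₀ hα₀ U₀ hU₀ hIn A hA J hJ => ?_⟩
  rw [withGopZdH_Gop]
  exact gopZdH_apply_eq_of_regularAtH i.η _ (i.Ω 0) U₀ (h M α₀ hα₀ U₀ hU₀ hIn).1 hA fun y μ hb => by rw [hJ y μ hb, deltaAOf_withGopZdH]

omit [CStarAlgebra 𝔸] [Nontrivial 𝔸] [FiniteDimensional ℝ 𝔸] in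
/-- a positive family over a finite type has a positive lower bound (and `1` serves the empty type). [folklore] -/
private theorem exists_pos_lower_bound_of_finite {S : Type*} [Finite S] (f : S → ℝ) (hf : ∀ s, 0 < f s) : ∃ c : ℝ, 0 < c ∧ ∀ s, c ≤ f s := by
  classical
  haveI := Fintype.ofFinite S
  by_cases hS : (Finset.univ : Finset S).Nonempty
  · refine ⟨Finset.univ.inf' hS f, ?_, fun s => Finset.inf'_le f (Finset.mem_univ s)⟩
    exact (Finset.lt_inf'_iff hS).2 fun s _ => hf s
  · refine ⟨1, one_pos, fun s => ?_⟩
    exact absurd ⟨s, Finset.mem_univ s⟩ hS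

include hτp hτt hτs in
/-- ★★ **ONE THRESHOLD FOR A FINITE FAMILY OF CUBE MEMBERS** — the family binder of `sockB9P3D4γIHI_allLevels_of_thm33_on` INHABITED over a finite index type:
cube presentations `(a j, Mc j, ρ j)` of `ι j`, `2 ≤ L ≤ ρ j` ⟹ `∃ aI > 0, ∀ j M m, m ≤ (ι j).k → InvAtHI L (withGopZdH (opsAllZd τ L (cubeLamBP L (a j) (Mc j) (ρ j)
(ι j).k) ops₀)) aI M (ι j) m` (each member's own record).  Across INFINITE families (all cube sizes) a common `aI` is print's uniform Theorem 3.11 — not claimed.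
[cite: Balaban1985BackgroundPropagators, Thm 3.11 p.416, (3.27) p.395; Balaban1985RegularSpaces, Thm 4 p.88, (1.131) p.99] -/
theorem invAtHI_withGopZdH_opsAllZd_cube_finite (hd2 : 2 ≤ d) (hL : 2 ≤ L) (ops₀ : ℝ → ZdIdx d L → ℕ → OpsZd d 𝔸)
    {J : Type*} [Finite J] (ι : J → ZdIdx d L) (a : J → Site d) (Mc ρ : J → ℕ) (hρ : ∀ j, L ≤ ρ j)
    (hΩ : ∀ j, (ι j).Ω = cubeFam false L (a j) (Mc j) (ρ j) (ι j).k) (hΛs : ∀ j, (ι j).Λs = cubeLamS L (a j) (Mc j) (ρ j) (ι j).k) :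
    ∃ aI : ℝ, 0 < aI ∧ ∀ (j : J) (M : ℝ) (m : ℕ), m ≤ (ι j).k →
      InvAtHI L (withGopZdH (opsAllZd τ L (cubeLamBP L (a j) (Mc j) (ρ j) (ι j).k) ops₀)) aI M (ι j) m := by
  classical
  -- one threshold per (member, level)
  have hmem : ∀ p : (Σ j : J, Fin ((ι j).k + 1)), ∃ aI : ℝ, 0 < aI ∧ ∀ M : ℝ,
      InvAtHI L (withGopZdH (opsAllZd τ L (cubeLamBP L (a p.1) (Mc p.1) (ρ p.1) (ι p.1).k) ops₀)) aI M (ι p.1) p.2 := fun p =>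
    invAtHI_withGopZdH_opsAllZd_cube_allM τ hτp hτt hτs hd2 hL ops₀ (ι p.1) (hρ p.1) (hΩ p.1) (hΛs p.1) (Nat.le_of_lt_succ p.2.2)
  choose f hf hF using hmem
  obtain ⟨c, hc, hcf⟩ := exists_pos_lower_bound_of_finite f hf
  refine ⟨c, hc, fun j M m hm => ?_⟩
  have h := hF ⟨j, ⟨m, Nat.lt_succ_of_le hm⟩⟩ M
  exact invAtHI_anti L (hcf ⟨j, ⟨m, Nat.lt_succ_of_le hm⟩⟩) h

end Uniform

/-! ## §4 The β collar socket at the concrete `ℤᵈ` frame: the dictionary discharged -/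

section Frame

variable {𝔸 : Type} [CStarAlgebra 𝔸] [Nontrivial 𝔸] (τ : 𝔸 →ₗ[ℂ] ℂ) [FiniteDimensional ℝ 𝔸] (L : ℕ)
  (hτp : ∀ a : 𝔸, a ≠ 0 → 0 < (τ (star a * a)).re) (hτt : ∀ a b : 𝔸, τ (a * b) = τ (b * a))
  (hτs : ∀ a : 𝔸, τ (star a) = starRingEnd ℂ (τ a))

include hτp hτt hτs in
/-- ★★★ **THE β COLLAR SOCKET AT A CUBE MEMBER FOR THE GENUINE RECORD, AT THE CONCRETE `ℤᵈ` FRAME, FROM PROP. 6 AND THEOREM 3.3's BLOCK ALONE.**  Frame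
`geo := geoZd 𝔸 L len`, `bg := bgZd 𝔸 L`, `GA := GAZdFam 𝔸 L len ops loc` for the record `ops := withGopZdH (opsAllZd τ L (cubeLamBP …) ops₀)` and ANY local
letters `loc`, `mem := memZd`, `ιCfg := ιCfgZd 𝔸 L`, `ιLoc := ιLocZd 𝔸 L len` (so `DictAt` is `dictGlob_zd` BY NAME): given `hP6 : Prop6At (bgZd 𝔸 L) L memZd
(ιCfgZd 𝔸 L) c35 c₆ K₆ M i m` and Theorem 3.3's (3.42)∕(3.47) block `h33U` for `G_𝔤(U₀)` at the frame's class (3.35), `∃ aI > 0` with the four-line collar socket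
`SockB9P3D4β L B₀′ ((20d+2)B₀′) cP i.η m i.Ω i.Λs (cubeLamBP …)`, constants as in `B9Thm311InvAtHIWitnessCubeZd.sockB9P3D4γ_withGopZdH_opsAllZd_cube`.
[cite: Balaban1985RegularSpaces, (1.58)–(1.59) p.86, Prop. 3 p.87, (1.131) p.99; Balaban1985BackgroundPropagators, Thm 3.3 p.399, (3.27) p.395, Thm 3.11 p.416, (3.47) p.398] -/
theorem sockB9P3D4γ_withGopZdH_opsAllZd_cube_zd [NeZero L] (hd2 : 2 ≤ d) (hL : 2 ≤ L)
    {Cτ : ℝ} (hCτ : ∀ x y : 𝔸, |(τ (star x * y)).re| ≤ Cτ * ‖x‖ * ‖y‖)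
    (len : Site d → ℝ) (ops₀ : ℝ → ZdIdx d L → ℕ → OpsZd d 𝔸) {c35 c₆ K₆ a₃ : ℝ} {M : ℝ} (hM1 : 1 ≤ M) (i : ZdIdx d L)
    {a : Site d} {Mc ρ : ℕ} (hρ : L ≤ ρ) (hΩ : i.Ω = cubeFam false L a Mc ρ i.k) (hΛs : i.Λs = cubeLamS L a Mc ρ i.k) {m : ℕ} (hm : m ≤ i.k)
    (loc : ∀ x : MemberZd d L, LocalLettersZd 𝔸 L x)
    (hP6 : Prop6At (bgZd 𝔸 L) L memZd (ιCfgZd 𝔸 L) c35 c₆ K₆ M i m)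
    (hK₆ : 0 < K₆) {B₀ δ₀ a₀ : ℝ} (hB₀ : 0 < B₀)
    (h33U : ∀ (α₀ : ℝ) (U₀ : Site d → Fin d → 𝔸ˣ) (hU₀ : ∀ x κ, U₀ x κ ∈ unitaryUnits 𝔸), 0 < α₀ → M * α₀ ≤ a₀ →
      (bgZd 𝔸 L (memZd M i m)).Reg335 c35 α₀ (ιCfgZd 𝔸 L M i m U₀ hU₀) →
      B9.Ineq342_346_347 (GAZdFam 𝔸 L len (withGopZdH (opsAllZd τ L (cubeLamBP L a Mc ρ i.k) ops₀)) loc (memZd M i m)) B₀ δ₀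
        (ιCfgZd 𝔸 L M i m U₀ hU₀)) :
    ∃ aI : ℝ, 0 < aI ∧
      SockB9P3D4β (𝔸 := 𝔸) L (max 1 (2 * B₀ * max 1 (qQ d L Cτ (betaTau τ) 1)))
        ((20 * d + 2) * max 1 (2 * B₀ * max 1 (qQ d L Cτ (betaTau τ) 1)))
        (min (1 / 16) (min (c₆ / M) (min (a₀ / (K₆ * M)) (min (a₃ / (K₆ * M)) (min aI (1 / (2 * B₀ * (14 * ((d - 1 : ℕ) : ℝ)) * M + 1)))))))
        i.η m i.Ω i.Λs (cubeLamBP L a Mc ρ i.k) :=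
  sockB9P3D4γ_withGopZdH_opsAllZd_cube (geoZd 𝔸 L len) (bgZd 𝔸 L)
    (GAZdFam 𝔸 L len (withGopZdH (opsAllZd τ L (cubeLamBP L a Mc ρ i.k) ops₀)) loc) L memZd (ιCfgZd 𝔸 L) (ιLocZd 𝔸 L len) τ hτp hτt hτs hd2 hL hCτ
    ops₀ hM1 i hρ hΩ hΛs hm (dictAt_of_global (dictGlob_zd len _ loc) M i m) hP6 hK₆ hB₀ h33U

end Frame

end Literature.MathematicalPhysics.QuantumFieldTheory.Balaban1983to89.B9Thm311InvAtHIWitnessCubeZdFamily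

end
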